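import Mathlib
import Literature.NumberTheory.LFunctions.Zhang2022.Section7dStatements
import Literature.NumberTheory.LFunctions.Zhang2022.Section7MainTermIdentities
import Literature.NumberTheory.LFunctions.Zhang2022.Section7Eq719
import HarnessLib

/-!
# Zhang (2022) §7 p. 39, (7.16)–(7.18): the series rearrangements of the main-term computation
# (nodes `Z22:(7.16)`, `Z22:§7.u043`, `Z22:(7.18)`) — DISCHARGED

Topic `Literature/NumberTheory/LFunctions/Zhang2022` (Landau–Siegel adjudication tree;
verdict-neutral). Y. Zhang, *Discrete mean estimates and the Landau–Siegel zero*,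
arXiv:2211.02515v1 (2022) [Zhang2022LandauSiegel], §7 "Proof of Proposition 7.1: the main term",
PDF p. 39, tex L2066–L2091:

> Assume `p ∼ P`. We may write
> `𝔗₁₁(p) = Σ_d d⁻¹ Σ_k a₂(dk)μ(k)/(kφ(k)) Σ_{(l,k)=1} (κ∗a₁)(dl)Δ(l/(pk))`.   (7.16)
> Since `(κ∗a₁)(dl) = … ` it follows, by substituting `m₁ = d₁l₁`, that
> `(κ∗a₁)(dl) = Σ_{d=d₁d₂} Σ_{l=l₁l₂,(l₁,d₂)=1} κ(d₁l₁)a₁(d₂l₂)`.   (7.17)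
> Hence `Σ_{(l,k)=1} (κ∗a₁)(dl)Δ(l/(pk)) = Σ_{d=d₁d₂} Σ_{(l₂,k)=1} a₁(d₂l₂) Σ_{(l₁,kd₂)=1}
> κ(d₁l₁)Δ(l₁l₂/(pk))`. Inserting this into (7.16) we obtain
> `𝔗₁₁(p) = Σ_{d₁}Σ_{d₂} (d₁d₂)⁻¹ Σ_k a₂(d₁d₂k)μ(k)/(kφ(k)) Σ_{(l₂,k)=1} a₁(d₂l₂)
> Σ_{(l₁,d₂k)=1} κ(d₁l₁)Δ(l₁l₂/(pk))`.   (7.18)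

The three displays other than (7.17) are typed by slice L2-t5 as `Section7dStatements.Eq716`,
`Step7u043`, `Eq718` (`Section7dStatements.lean`); (7.17) is the tree theorem
`Section7MainTerm.conv_eq_sum_divisors_coprime` (`Section7MainTermIdentities.lean`). This file
PROVES the three (`eq716_holds`, `step7u043_holds`, `eq718_holds`), for every modulus `D ≥ 3`
((A) is not used), i.e. it supplies the convergence bookkeeping the manuscript leaves implicit:

* `hasSum_fiber_rearrangement`: for fixed `d₁, d₂`, the double series
  `Σ_{l₁,l₂} a₁(d₂l₂)κ(d₁l₁)Δ(l₁l₂/(pk))` (with the coprimality indicators) converges absolutely —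
  `|a₁| ≤ B` and `a₁(n) = 0` for `n ≥ PT⁻²` ((7.2), `Skeleton.Adm72`), `‖Δ(x)‖ ≤ M/x²`
  (`exists_norm_DeltaW_le_div_sq`, from the tree's trivial bound and super-polynomial decay of
  `Δ`, `Section5DeltaAnalytic`), `Σ_l |κ(d₁l)| l^{−3/2} < ∞` (tree `LSeriesSummable_kappa`) — so it
  may be summed by the fibres `l₁l₂ = l` (Mathlib `HasSum.tsum_fiberwise`, fibres =
  `Nat.divisorsAntidiagonal`, as in Mathlib's `LSeries.term_convolution'`) or iteratively
  (`Summable.tsum_prod`, `Summable.tsum_comm`); the coprimality conditions split as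
  `(l₁l₂,k)=1 ⇔ (l₁,k)=(l₂,k)=1`, `(l₁,d₂k)=1 ⇔ (l₁,d₂)=(l₁,k)=1`;
* `hasSum_u043` / `step7u043_holds`: summing over `d₁ ∣ d` and inserting (7.17);
* `tsum_sum_filter_eq` / `eq716_holds`: the `k`/`l` interchange in `𝔗₁₁(p)` (finite `k`-sum
  against a summable `l`-series);
* `eq718_holds`: (7.16) + `Z22:§7.u043`, the pair `(d, d₁ ∣ d)` re-indexed as `(d₁, d₂)` with
  `d = d₁d₂ < ⌈PT⁻²⌉` (`sum_sum_eq_sum_divisors`), the terms with `d₁d₂ ≥ ⌈PT⁻²⌉` vanishing by the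
  support clause of (7.2) for `a₂`.

No new definitions (one `private` abbreviation for the double-series summand), no named facts, no
`sorry`; nothing here bears on Theorems 1–2 of the source or on Landau–Siegel zeros.

## References

* Y. Zhang, arXiv:2211.02515v1 (2022), §7 (7.16)–(7.18) p. 39, tex L2066–L2091; (7.2).
  [cite: Zhang2022LandauSiegel, (7.16)–(7.18) p.39]
-/

noncomputable section

open Complex Real MeasureTheory Set Filter Finset

namespace Literature.NumberTheory.LFunctions.Zhang2022.Section7dStatements

/-! ## Analytic input: decay of `Δ` (the summability `Σ_l |κ(d₁l)| l^{−3/2} < ∞` is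
`summable_norm_kappaZ_mul_rpow` of `Section7Eq719`) -/

/-- `𝓛₂ ≥ 1` for `D ≥ 3`. [cite: Zhang2022LandauSiegel, §2 (2.15)] -/
private theorem one_le_ell2' {D : ℕ} (hD : 3 ≤ D) : 1 ≤ Skeleton.ell2 D := by
  have hD' : (3 : ℝ) ≤ D := by exact_mod_cast hD
  have h1 : (1 : ℝ) < Real.log 3 := by
    rw [Real.lt_log_iff_exp_lt (by norm_num)]
    exact Real.exp_one_lt_d9.trans (by norm_num)
  have hℓ : 1 ≤ Skeleton.ell D := le_trans h1.le (Real.log_le_log (by norm_num) hD')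
  exact one_le_pow₀ hℓ

/-- **Decay of `Δ`**: `‖Δ(x)‖ ≤ M/x²` for all `x > 0` (`D ≥ 3`), from the trivial bound
(`Lemma53.norm_Delta510_le`) on `(0,1)` and the super-polynomial decay
(`Lemma53.exists_norm_Delta510_le_rpow_neg`, `k = 2`) on `[1,∞)`.
[cite: Zhang2022LandauSiegel, §5 Lemma 5.3 (5.9)] -/
theorem exists_norm_DeltaW_le_div_sq {D : ℕ} (hD : 3 ≤ D) :
    ∃ M : ℝ, 0 ≤ M ∧ ∀ x : ℝ, 0 < x → ‖Skeleton.DeltaW D x‖ ≤ M / x ^ 2 := by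
  have hL : 1 ≤ Skeleton.ell2 D := one_le_ell2' hD
  have hL0 : 0 < Skeleton.ell2 D := by linarith
  set C₀ : ℝ := Real.exp (1 / (16 * Skeleton.ell2 D ^ 2)) * (Real.sqrt π / Skeleton.ell2 D)
    with hC₀
  have hC₀0 : 0 ≤ C₀ := by positivity
  obtain ⟨C₂, hC₂0, hC₂⟩ := Lemma53.exists_norm_Delta510_le_rpow_neg hL (Skeleton.t0 D) 2
  refine ⟨C₀ + C₂, by positivity, fun x hx => ?_⟩
  rw [Skeleton.DeltaW, Lemma53.Delta57_eq_Delta510 hL0 _ hx]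
  have hx2 : 0 < x ^ 2 := by positivity
  rcases le_or_gt 1 x with h1 | h1
  · have h := hC₂ x h1
    have hr : x ^ (-((2 : ℕ) : ℝ)) = (x ^ 2)⁻¹ := by
      rw [Real.rpow_neg hx.le, show ((2 : ℕ) : ℝ) = (2 : ℕ) by norm_cast, Real.rpow_natCast]
    rw [hr, ← div_eq_mul_inv] at h
    exact h.trans (div_le_div_of_nonneg_right (by linarith) hx2.le)
  · have h := Lemma53.norm_Delta510_le hL0 (Skeleton.t0 D) x
    have hx21 : x ^ 2 ≤ 1 := by nlinarith
    calc ‖Lemma53.Delta510 (Skeleton.ell2 D) (Skeleton.t0 D) x‖ ≤ C₀ := h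
      _ ≤ C₀ / x ^ 2 := by
          rw [le_div_iff₀ hx2]; nlinarith
      _ ≤ (C₀ + C₂) / x ^ 2 := div_le_div_of_nonneg_right (by linarith) hx2.le

/-! ## The absolutely convergent double series behind `Z22:§7.u043` -/

section DoubleSeries

variable {c' : ℝ} {D : ℕ} {a₁ : ℕ → ℂ} {d₁ d₂ k p : ℕ} {H : ℕ × ℕ → ℂ}

/-! Throughout this section `H` is the summand of the double series
`Σ_{l₁,l₂} a₁(d₂l₂)κ(d₁l₁)Δ(l₁l₂/(pk))` over `(l₁,d₂k) = 1`, `(l₂,k) = 1` (§7 p. 39, "Hence …"),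
recorded by the hypothesis `hHdef` (no auxiliary definition is introduced). -/

/-- **Absolute convergence of the double series** (from (7.2): `|a₁| ≤ B`, `a₁(n) = 0` for
`n ≥ PT⁻²`; the decay `‖Δ(x)‖ ≤ M/x²`; `Σ|κ(d₁l)|l^{−3/2} < ∞`).
[cite: Zhang2022LandauSiegel, §7 p.39, tex L2082] -/
private theorem summable_dblTerm (hHdef : ∀ q : ℕ × ℕ, H q =
      (if 0 < q.2 ∧ Nat.Coprime q.2 k then a₁ (d₂ * q.2) else 0) *
        (if 0 < q.1 ∧ Nat.Coprime q.1 (d₂ * k) then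
          Skeleton.kappaZ c' D (d₁ * q.1) *
            Skeleton.DeltaW D ((q.1 : ℝ) * ((q.2 : ℝ) / ((p : ℝ) * k))) else 0))
    (hD : 3 ≤ D) {B : ℝ} (ha : Skeleton.Adm72 D B a₁)
    (hd₁ : 0 < d₁) (hd₂ : 0 < d₂) (hk : 0 < k) (hp : 0 < p) :
    Summable H := by
  obtain ⟨hB, hsupp⟩ := ha
  have hB0 : 0 ≤ B := le_trans (norm_nonneg _) (hB 0)
  obtain ⟨M, hM0, hM⟩ := exists_norm_DeltaW_le_div_sq hD
  have hpk : (0 : ℝ) < (p : ℝ) * k := by positivity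
  -- the majorant `(B·M·(pk)²·|κ(d₁l₁)|·l₁^{-3/2}) · 𝟙[l₂ < N]`, `N = ⌈PT⁻²⌉`
  set f : ℕ → ℝ := fun l₁ => B * M * ((p : ℝ) * k) ^ 2 *
    (‖Skeleton.kappaZ c' D (d₁ * l₁)‖ * (l₁ : ℝ) ^ (-(3 / 2 : ℝ))) with hf
  set g : ℕ → ℝ := fun l₂ => if l₂ < Skeleton.Nsupp D then 1 else 0 with hg
  have hfs : Summable f := (summable_norm_kappaZ_mul_rpow c' D hd₁).mul_left _
  have hgs : Summable g := by
    refine summable_of_ne_finset_zero (s := Finset.range (Skeleton.Nsupp D)) fun l₂ hl₂ => ?_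
    simp only [hg, Finset.mem_range.not.mp hl₂, if_false]
  have hf0 : 0 ≤ f := fun l₁ => by simp only [hf, Pi.zero_apply]; positivity
  have hg0 : 0 ≤ g := fun l₂ => by
    simp only [hg, Pi.zero_apply]; split_ifs <;> norm_num
  have hfg0 : ∀ q : ℕ × ℕ, 0 ≤ f q.1 * g q.2 := fun q => mul_nonneg (hf0 q.1) (hg0 q.2)
  refine Summable.of_norm_bounded (hfs.mul_of_nonneg hgs hf0 hg0) fun q => ?_
  obtain ⟨l₁, l₂⟩ := q
  -- vanishing cases
  by_cases h₂ : 0 < l₂ ∧ Nat.Coprime l₂ k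
  swap
  · have : H (l₁, l₂) = 0 := by
      simp only [hHdef, if_neg h₂, zero_mul]
    rw [this, norm_zero]; exact hfg0 (l₁, l₂)
  by_cases h₁ : 0 < l₁ ∧ Nat.Coprime l₁ (d₂ * k)
  swap
  · have : H (l₁, l₂) = 0 := by
      simp only [hHdef, if_neg h₁, mul_zero]
    rw [this, norm_zero]; exact hfg0 (l₁, l₂)
  have hval : H (l₁, l₂) = a₁ (d₂ * l₂) *
      (Skeleton.kappaZ c' D (d₁ * l₁) *
        Skeleton.DeltaW D ((l₁ : ℝ) * ((l₂ : ℝ) / ((p : ℝ) * k)))) := by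
    simp only [hHdef, if_pos h₂, if_pos h₁]
  rw [hval]
  by_cases hlN : l₂ < Skeleton.Nsupp D
  swap
  · -- `l₂ ≥ N = ⌈PT⁻²⌉`: then `a₁(d₂l₂) = 0` by the support clause of (7.2)
    have hge : Skeleton.bigP D / Skeleton.bigT D ^ 2 ≤ ((d₂ * l₂ : ℕ) : ℝ) := by
      have h1 : Skeleton.bigP D / Skeleton.bigT D ^ 2 ≤ (Skeleton.Nsupp D : ℝ) := Nat.le_ceil _
      have h2 : (Skeleton.Nsupp D : ℝ) ≤ l₂ := by exact_mod_cast not_lt.mp hlN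
      have h3 : (l₂ : ℝ) ≤ ((d₂ * l₂ : ℕ) : ℝ) := by
        rw [Nat.cast_mul]
        exact le_mul_of_one_le_left (Nat.cast_nonneg _) (by exact_mod_cast hd₂)
      linarith
    rw [hsupp _ hge, zero_mul, norm_zero]
    exact hfg0 (l₁, l₂)
  -- main case: `1 ≤ l₂ < N`, `1 ≤ l₁`
  have hl₁ : (1 : ℝ) ≤ l₁ := by exact_mod_cast h₁.1
  have hl₂ : (1 : ℝ) ≤ l₂ := by exact_mod_cast h₂.1
  have hl₁0 : (0 : ℝ) < l₁ := by linarith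
  have hl₂0 : (0 : ℝ) < l₂ := by linarith
  have hx : 0 < (l₁ : ℝ) * ((l₂ : ℝ) / ((p : ℝ) * k)) := by positivity
  have hg1 : g l₂ = 1 := by simp only [hg, if_pos hlN]
  -- `‖Δ(l₁l₂/(pk))‖ ≤ M (pk)² / (l₁² l₂²) ≤ M (pk)² l₁^{-3/2}`
  have hΔ : ‖Skeleton.DeltaW D ((l₁ : ℝ) * ((l₂ : ℝ) / ((p : ℝ) * k)))‖ ≤
      M * ((p : ℝ) * k) ^ 2 * (l₁ : ℝ) ^ (-(3 / 2 : ℝ)) := by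
    refine (hM _ hx).trans ?_
    rw [div_le_iff₀ (pow_pos hx 2)]
    have hr : (l₁ : ℝ) ^ (-(3 / 2 : ℝ)) * (l₁ : ℝ) ^ 2 = (l₁ : ℝ) ^ (1 / 2 : ℝ) := by
      rw [← Real.rpow_two, ← Real.rpow_add hl₁0]; norm_num
    have h12 : (1 : ℝ) ≤ (l₁ : ℝ) ^ (1 / 2 : ℝ) := Real.one_le_rpow hl₁ (by norm_num)
    have hl₂2 : (1 : ℝ) ≤ (l₂ : ℝ) ^ 2 := one_le_pow₀ hl₂
    have hone : 1 ≤ (l₁ : ℝ) ^ (-(3 / 2 : ℝ)) * ((l₁ : ℝ) ^ 2 * (l₂ : ℝ) ^ 2) := by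
      rw [← mul_assoc, hr]
      nlinarith
    have hexp : M * ((p : ℝ) * k) ^ 2 * (l₁ : ℝ) ^ (-(3 / 2 : ℝ)) *
        ((l₁ : ℝ) * ((l₂ : ℝ) / ((p : ℝ) * k))) ^ 2 =
        M * ((l₁ : ℝ) ^ (-(3 / 2 : ℝ)) * ((l₁ : ℝ) ^ 2 * (l₂ : ℝ) ^ 2)) := by
      field_simp
    rw [hexp]
    calc M = M * 1 := (mul_one M).symm
      _ ≤ M * ((l₁ : ℝ) ^ (-(3 / 2 : ℝ)) * ((l₁ : ℝ) ^ 2 * (l₂ : ℝ) ^ 2)) :=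
          mul_le_mul_of_nonneg_left hone hM0
  rw [hg1, mul_one, norm_mul, norm_mul]
  calc ‖a₁ (d₂ * l₂)‖ * (‖Skeleton.kappaZ c' D (d₁ * l₁)‖ *
        ‖Skeleton.DeltaW D ((l₁ : ℝ) * ((l₂ : ℝ) / ((p : ℝ) * k)))‖)
      ≤ B * (‖Skeleton.kappaZ c' D (d₁ * l₁)‖ *
          (M * ((p : ℝ) * k) ^ 2 * (l₁ : ℝ) ^ (-(3 / 2 : ℝ)))) := by
        gcongr
        exact hB _
    _ = f l₁ := by simp only [hf]; ring

/-- `Σ'_{l₁} H(l₁,l₂) = 𝟙[l₂]·a₁(d₂l₂)·(innermost sum)` — the inner series of the rearranged form.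
[cite: Zhang2022LandauSiegel, §7 p.39, tex L2082] -/
private theorem tsum_dblTerm_fst (hHdef : ∀ q : ℕ × ℕ, H q =
      (if 0 < q.2 ∧ Nat.Coprime q.2 k then a₁ (d₂ * q.2) else 0) *
        (if 0 < q.1 ∧ Nat.Coprime q.1 (d₂ * k) then
          Skeleton.kappaZ c' D (d₁ * q.1) *
            Skeleton.DeltaW D ((q.1 : ℝ) * ((q.2 : ℝ) / ((p : ℝ) * k))) else 0)) (l₂ : ℕ) :
    ∑' l₁ : ℕ, H (l₁, l₂) =
      if 0 < l₂ ∧ Nat.Coprime l₂ k then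
        a₁ (d₂ * l₂) * innerDeltaSum c' D d₁ (d₂ * k) ((l₂ : ℝ) / ((p : ℝ) * k)) else 0 := by
  simp only [hHdef]
  rw [tsum_mul_left, innerDeltaSum]
  split_ifs <;> simp

/-- On the fibre `l₁l₂ = n` (`n ≥ 1`) the double-series summand sums to the `n`-th term of the
left side of `Z22:§7.u043` (coprimality splits: `(l₁l₂,k)=1 ⇔ (l₁,k)=(l₂,k)=1`,
`(l₁,d₂k)=1 ⇔ (l₁,d₂)=(l₁,k)=1`). [cite: Zhang2022LandauSiegel, §7 p.39, tex L2082] -/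
private theorem sum_antidiag_dblTerm (hHdef : ∀ q : ℕ × ℕ, H q =
      (if 0 < q.2 ∧ Nat.Coprime q.2 k then a₁ (d₂ * q.2) else 0) *
        (if 0 < q.1 ∧ Nat.Coprime q.1 (d₂ * k) then
          Skeleton.kappaZ c' D (d₁ * q.1) *
            Skeleton.DeltaW D ((q.1 : ℝ) * ((q.2 : ℝ) / ((p : ℝ) * k))) else 0)) {n : ℕ} (hn : 0 < n) :
    ∑ x ∈ n.divisorsAntidiagonal, H x =
      if 0 < n ∧ Nat.Coprime n k then
        (∑ x ∈ n.divisorsAntidiagonal.filter (fun x => Nat.Coprime x.1 d₂),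
            Skeleton.kappaZ c' D (d₁ * x.1) * a₁ (d₂ * x.2)) *
          Skeleton.DeltaW D ((n : ℝ) / ((p : ℝ) * k)) else 0 := by
  have hmem : ∀ x ∈ n.divisorsAntidiagonal, x.1 * x.2 = n ∧ 0 < x.1 ∧ 0 < x.2 := by
    intro x hx
    have h := (Nat.mem_divisorsAntidiagonal.mp hx).1
    refine ⟨h, Nat.pos_of_ne_zero fun h0 => ?_, Nat.pos_of_ne_zero fun h0 => ?_⟩
    · rw [h0, zero_mul] at h; omega
    · rw [h0, mul_zero] at h; omega
  have harg : ∀ x ∈ n.divisorsAntidiagonal,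
      (x.1 : ℝ) * ((x.2 : ℝ) / ((p : ℝ) * k)) = (n : ℝ) / ((p : ℝ) * k) := by
    intro x hx
    rw [← (hmem x hx).1, Nat.cast_mul]; ring
  by_cases hcop : Nat.Coprime n k
  · rw [if_pos ⟨hn, hcop⟩, Finset.sum_filter, Finset.sum_mul]
    refine Finset.sum_congr rfl fun x hx => ?_
    obtain ⟨hx12, hx1, hx2⟩ := hmem x hx
    have hc1 : Nat.Coprime x.1 k :=
      Nat.Coprime.coprime_dvd_left (Dvd.intro _ hx12) hcop
    have hc2 : Nat.Coprime x.2 k :=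
      Nat.Coprime.coprime_dvd_left (Dvd.intro_left _ hx12) hcop
    have h2 : (0 < x.2 ∧ Nat.Coprime x.2 k) := ⟨hx2, hc2⟩
    by_cases hd : Nat.Coprime x.1 d₂
    · have h1 : (0 < x.1 ∧ Nat.Coprime x.1 (d₂ * k)) :=
        ⟨hx1, Nat.coprime_mul_iff_right.mpr ⟨hd, hc1⟩⟩
      rw [hHdef, if_pos h2, if_pos h1, if_pos hd, harg x hx]
      ring
    · have h1 : ¬ (0 < x.1 ∧ Nat.Coprime x.1 (d₂ * k)) :=
        fun h => hd (Nat.coprime_mul_iff_right.mp h.2).1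
      rw [hHdef, if_pos h2, if_neg h1, if_neg hd, mul_zero, zero_mul]
  · rw [if_neg (fun h => hcop h.2)]
    refine Finset.sum_eq_zero fun x hx => ?_
    obtain ⟨hx12, hx1, hx2⟩ := hmem x hx
    by_cases hc2 : Nat.Coprime x.2 k
    · have h1 : ¬ (0 < x.1 ∧ Nat.Coprime x.1 (d₂ * k)) := by
        intro h1
        have h1k : Nat.Coprime x.1 k := (Nat.coprime_mul_iff_right.mp h1.2).2
        exact hcop (hx12 ▸ Nat.Coprime.mul_left h1k hc2)
      rw [hHdef, if_neg h1, mul_zero]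
    · have h2 : ¬ (0 < x.2 ∧ Nat.Coprime x.2 k) := fun h => hc2 h.2
      rw [hHdef, if_neg h2, zero_mul]

/-- The double series, summed first over `l₁`, is the rearranged (right) side of `Z22:§7.u043`
for the divisor `d₁`. [cite: Zhang2022LandauSiegel, §7 p.39, tex L2082] -/
private theorem tsum_dblTerm_eq (hHdef : ∀ q : ℕ × ℕ, H q =
      (if 0 < q.2 ∧ Nat.Coprime q.2 k then a₁ (d₂ * q.2) else 0) *
        (if 0 < q.1 ∧ Nat.Coprime q.1 (d₂ * k) then
          Skeleton.kappaZ c' D (d₁ * q.1) *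
            Skeleton.DeltaW D ((q.1 : ℝ) * ((q.2 : ℝ) / ((p : ℝ) * k))) else 0)) (hH : Summable H) :
    ∑' q : ℕ × ℕ, H q =
      ∑' l₂ : ℕ, if 0 < l₂ ∧ Nat.Coprime l₂ k then
        a₁ (d₂ * l₂) * innerDeltaSum c' D d₁ (d₂ * k) ((l₂ : ℝ) / ((p : ℝ) * k)) else 0 := by
  have hHu : Summable (Function.uncurry fun l₁ l₂ : ℕ => H (l₁, l₂)) :=
    hH.congr fun q => by obtain ⟨a, b⟩ := q; rfl
  calc ∑' q : ℕ × ℕ, H q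
      = ∑' l₁ : ℕ, ∑' l₂ : ℕ, H (l₁, l₂) := hH.tsum_prod
    _ = ∑' l₂ : ℕ, ∑' l₁ : ℕ, H (l₁, l₂) := hHu.tsum_comm.symm
    _ = _ := tsum_congr fun l₂ => tsum_dblTerm_fst hHdef l₂

/-- The double series summed over the fibre `l₁l₂ = n` is the `n`-th term of the left side of
`Z22:§7.u043`. [cite: Zhang2022LandauSiegel, §7 p.39, tex L2082] -/
private theorem tsum_fiber_dblTerm_eq (hHdef : ∀ q : ℕ × ℕ, H q =
      (if 0 < q.2 ∧ Nat.Coprime q.2 k then a₁ (d₂ * q.2) else 0) *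
        (if 0 < q.1 ∧ Nat.Coprime q.1 (d₂ * k) then
          Skeleton.kappaZ c' D (d₁ * q.1) *
            Skeleton.DeltaW D ((q.1 : ℝ) * ((q.2 : ℝ) / ((p : ℝ) * k))) else 0)) (n : ℕ) :
    ∑' b : ↥((fun q : ℕ × ℕ => q.1 * q.2) ⁻¹' {n}), H b =
      if 0 < n ∧ Nat.Coprime n k then
        (∑ x ∈ n.divisorsAntidiagonal.filter (fun x => Nat.Coprime x.1 d₂),
            Skeleton.kappaZ c' D (d₁ * x.1) * a₁ (d₂ * x.2)) *
          Skeleton.DeltaW D ((n : ℝ) / ((p : ℝ) * k)) else 0 := by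
  rcases Nat.eq_zero_or_pos n with rfl | hn
  · have hzero : ∀ b : ↥((fun q : ℕ × ℕ => q.1 * q.2) ⁻¹' {0}), H b = 0 := by
      rintro ⟨⟨l₁, l₂⟩, hb⟩
      simp only [Set.mem_preimage, Set.mem_singleton_iff, mul_eq_zero] at hb
      rcases hb with h | h
      · have : ¬ (0 < l₁ ∧ Nat.Coprime l₁ (d₂ * k)) := fun h' => by omega
        rw [hHdef, if_neg this, mul_zero]
      · have : ¬ (0 < l₂ ∧ Nat.Coprime l₂ k) := fun h' => by omega
        rw [hHdef, if_neg this, zero_mul]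
    rw [tsum_congr hzero, tsum_zero, if_neg (fun h => lt_irrefl 0 h.1)]
  · have hS : (fun q : ℕ × ℕ => q.1 * q.2) ⁻¹' {n} = ↑n.divisorsAntidiagonal := by
      ext q
      simp only [Set.mem_preimage, Set.mem_singleton_iff, Finset.mem_coe,
        Nat.mem_divisorsAntidiagonal, ne_eq, hn.ne', not_false_eq_true, and_true]
    rw [hS, Finset.tsum_subtype' n.divisorsAntidiagonal H]
    exact sum_antidiag_dblTerm hHdef hn

/-- **The rearrangement behind `Z22:§7.u043`, for one divisor `d₁` of `d`** (`d₂ = d/d₁`): the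
series `Σ_{l≥1,(l,k)=1} (Σ_{l=l₁l₂,(l₁,d₂)=1} κ(d₁l₁)a₁(d₂l₂)) Δ(l/(pk))` HAS SUM equal to the
rearranged `Σ_{(l₂,k)=1} a₁(d₂l₂) Σ_{(l₁,d₂k)=1} κ(d₁l₁)Δ(l₁l₂/(pk))` (absolutely convergent
double series over `(l₁,l₂)`, summed by the fibres `l₁l₂ = l`).
[cite: Zhang2022LandauSiegel, §7 p.39, tex L2082] -/
theorem hasSum_fiber_rearrangement (c' : ℝ) (hD : 3 ≤ D) {B : ℝ} (ha : Skeleton.Adm72 D B a₁)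
    (hd₁ : 0 < d₁) (hd₂ : 0 < d₂) (hk : 0 < k) (hp : 0 < p) :
    HasSum (fun l : ℕ => if 0 < l ∧ Nat.Coprime l k then
        (∑ x ∈ l.divisorsAntidiagonal.filter (fun x => Nat.Coprime x.1 d₂),
            Skeleton.kappaZ c' D (d₁ * x.1) * a₁ (d₂ * x.2)) *
          Skeleton.DeltaW D ((l : ℝ) / ((p : ℝ) * k)) else 0)
      (∑' l₂ : ℕ, if 0 < l₂ ∧ Nat.Coprime l₂ k then
        a₁ (d₂ * l₂) * innerDeltaSum c' D d₁ (d₂ * k) ((l₂ : ℝ) / ((p : ℝ) * k)) else 0) := by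
  set H : ℕ × ℕ → ℂ := fun q =>
    (if 0 < q.2 ∧ Nat.Coprime q.2 k then a₁ (d₂ * q.2) else 0) *
        (if 0 < q.1 ∧ Nat.Coprime q.1 (d₂ * k) then
          Skeleton.kappaZ c' D (d₁ * q.1) *
            Skeleton.DeltaW D ((q.1 : ℝ) * ((q.2 : ℝ) / ((p : ℝ) * k))) else 0) with hH0
  have hHdef : ∀ q : ℕ × ℕ, H q =
      (if 0 < q.2 ∧ Nat.Coprime q.2 k then a₁ (d₂ * q.2) else 0) *
        (if 0 < q.1 ∧ Nat.Coprime q.1 (d₂ * k) then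
          Skeleton.kappaZ c' D (d₁ * q.1) *
            Skeleton.DeltaW D ((q.1 : ℝ) * ((q.2 : ℝ) / ((p : ℝ) * k))) else 0) :=
    fun q => by rw [hH0]
  have hH : Summable H := summable_dblTerm hHdef hD ha hd₁ hd₂ hk hp
  have hfib := hH.hasSum.tsum_fiberwise (fun q : ℕ × ℕ => q.1 * q.2)
  rw [tsum_dblTerm_eq hHdef hH] at hfib
  refine hfib.congr_fun fun n => ?_
  exact (tsum_fiber_dblTerm_eq hHdef n).symm

end DoubleSeries

/-! ## `Z22:§7.u043` -/

section U043

variable (c' : ℝ) {D : ℕ}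

/-- For `l ≥ 1`, (7.17) inserted into the `l`-th term (d28's `Section7MainTerm.conv_eq_sum_divisors_coprime`),
and trivially for `l = 0`: the `l`-th term of the left side of `Z22:§7.u043` is the sum over
`d₁ ∣ d` of the fibre terms. [cite: Zhang2022LandauSiegel, §7 (7.17) p.39] -/
private theorem u043_term_eq (a₁ : ℕ → ℂ) {d : ℕ} (hd : 0 < d) (k p l : ℕ) :
    (if 0 < l ∧ Nat.Coprime l k then
        MeanSquareMajorant.conv (Skeleton.kappaZ c' D) a₁ (d * l) *
          Skeleton.DeltaW D ((l : ℝ) / ((p : ℝ) * k)) else 0) =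
      ∑ d₁ ∈ d.divisors, (if 0 < l ∧ Nat.Coprime l k then
        (∑ x ∈ l.divisorsAntidiagonal.filter (fun x => Nat.Coprime x.1 (d / d₁)),
            Skeleton.kappaZ c' D (d₁ * x.1) * a₁ (d / d₁ * x.2)) *
          Skeleton.DeltaW D ((l : ℝ) / ((p : ℝ) * k)) else 0) := by
  split_ifs with h
  · rw [Section7MainTerm.conv_eq_sum_divisors_coprime _ a₁ d l hd h.1, Finset.sum_mul]
  · simp

/-- **The left side of `Z22:§7.u043` is an (absolutely) summable series** with sum
`Σ_{d₁∣d} Σ_{(l₂,k)=1} a₁(d₂l₂) Σ_{(l₁,kd₂)=1} κ(d₁l₁)Δ(l₁l₂/(pk))` (`D ≥ 3`, `a₁` admissible (7.2)).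
[cite: Zhang2022LandauSiegel, §7 p.39, tex L2082] -/
theorem hasSum_u043 (hD : 3 ≤ D) {B : ℝ} {a₁ : ℕ → ℂ} (ha : Skeleton.Adm72 D B a₁)
    {d k p : ℕ} (hd : 0 < d) (hk : 0 < k) (hp : 0 < p) :
    HasSum (fun l : ℕ => if 0 < l ∧ Nat.Coprime l k then
        MeanSquareMajorant.conv (Skeleton.kappaZ c' D) a₁ (d * l) *
          Skeleton.DeltaW D ((l : ℝ) / ((p : ℝ) * k)) else 0)
      (∑ d₁ ∈ d.divisors,
        ∑' l₂ : ℕ, if 0 < l₂ ∧ Nat.Coprime l₂ k then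
          a₁ (d / d₁ * l₂) *
            innerDeltaSum c' D d₁ (d / d₁ * k) ((l₂ : ℝ) / ((p : ℝ) * k)) else 0) := by
  have hfam : ∀ d₁ ∈ d.divisors, HasSum (fun l : ℕ => if 0 < l ∧ Nat.Coprime l k then
      (∑ x ∈ l.divisorsAntidiagonal.filter (fun x => Nat.Coprime x.1 (d / d₁)),
          Skeleton.kappaZ c' D (d₁ * x.1) * a₁ (d / d₁ * x.2)) *
        Skeleton.DeltaW D ((l : ℝ) / ((p : ℝ) * k)) else 0)
      (∑' l₂ : ℕ, if 0 < l₂ ∧ Nat.Coprime l₂ k then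
          a₁ (d / d₁ * l₂) *
            innerDeltaSum c' D d₁ (d / d₁ * k) ((l₂ : ℝ) / ((p : ℝ) * k)) else 0) := by
    intro d₁ hd₁
    have hd₁0 : 0 < d₁ := Nat.pos_of_mem_divisors hd₁
    have hd₂0 : 0 < d / d₁ := Nat.div_pos (Nat.divisor_le hd₁) hd₁0
    exact hasSum_fiber_rearrangement c' hD ha hd₁0 hd₂0 hk hp
  have h := hasSum_sum hfam
  refine h.congr_fun fun l => ?_
  exact (u043_term_eq c' a₁ hd k p l)

/-- **`Z22:§7.u043` HOLDS** (node `Section7dStatements.Step7u043 c′`; §7 p. 39, tex L2082–L2086: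
"Hence `Σ_{(l,k)=1} (κ∗a₁)(dl)Δ(l/(pk)) = Σ_{d=d₁d₂} Σ_{(l₂,k)=1} a₁(d₂l₂) Σ_{(l₁,kd₂)=1}
κ(d₁l₁)Δ(l₁l₂/(pk))`") — (7.17) summed against `Δ` and rearranged as an absolutely convergent
double series; for all `D ≥ 3` ((A) is not used). [cite: Zhang2022LandauSiegel, §7 p.39, tex L2082] -/
theorem step7u043_holds (c' : ℝ) : Step7u043 c' := by
  intro B
  refine ⟨3, fun D _ χ hD _ _ _ a₁ ha p hp d k hd hk => ?_⟩
  have hp' : 0 < p := by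
    simp only [Skeleton.primeWindow, Finset.mem_filter] at hp
    exact hp.2.pos
  exact (hasSum_u043 c' hD ha hd hk hp').tsum_eq

variable (c' : ℝ) in
/-- `Step7u043` — `_holds` alias of `step7u043_holds` above under the fact's exact name, stated under the
prover's own binders as section variables (appended 2026-08-28, D-0026 bookkeeping: the proof term is the
existing theorem of this file; no statement, definition or attribute is edited; no new named fact; the
ledger's debt table listed the fact unproved). [cite: Zhang2022LandauSiegel, §7 p.39, tex L2082] -/
theorem _root_.Literature.NumberTheory.LFunctions.Zhang2022.Section7dStatements.Step7u043_holds :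
    _root_.Literature.NumberTheory.LFunctions.Zhang2022.Section7dStatements.Step7u043 c' :=
  _root_.Literature.NumberTheory.LFunctions.Zhang2022.Section7dStatements.step7u043_holds (c' := c')

end U043

/-! ## `Z22:(7.16)` -/

section Eq716

variable (c' : ℝ) {D : ℕ}

/-- `(κ ∗ a₁)(0) = 0` (empty divisor antidiagonal). [folklore] -/
private theorem conv_zero (κ : ArithmeticFunction ℂ) (a : ℕ → ℂ) :
    MeanSquareMajorant.conv κ a 0 = 0 := by
  simp [MeanSquareMajorant.conv]

/-- **The `k`/`l` interchange of (7.16), for one `d`**: the series over `l` of the finite `k`-sums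
in the definition of `𝔗₁₁(p)` equals the finite `k`-sum of the series over `l`, each `l`-series
being summable (`hasSum_u043`). [cite: Zhang2022LandauSiegel, §7 (7.16) p.39, tex L2070] -/
theorem tsum_sum_filter_eq (hD : 3 ≤ D) {B : ℝ} {a₁ : ℕ → ℂ} (ha : Skeleton.Adm72 D B a₁)
    (a₂ : ℕ → ℂ) {d p : ℕ} (hd : 0 < d) (hp : 0 < p) :
    (∑' l : ℕ, ∑ k ∈ (Finset.Ico 1 (Skeleton.Nsupp D)).filter (fun k => Nat.Coprime k l),
        MeanSquareMajorant.conv (Skeleton.kappaZ c' D) a₁ (d * l) * a₂ (d * k) *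
            (ArithmeticFunction.moebius k : ℂ) / ((k : ℂ) * (Nat.totient k : ℂ)) *
          Skeleton.DeltaW D ((l : ℝ) / ((p : ℝ) * k))) =
      ∑ k ∈ Finset.Ico 1 (Skeleton.Nsupp D),
        a₂ (d * k) * (ArithmeticFunction.moebius k : ℂ) / ((k : ℂ) * (Nat.totient k : ℂ)) *
          ∑' l : ℕ, if 0 < l ∧ Nat.Coprime l k then
            MeanSquareMajorant.conv (Skeleton.kappaZ c' D) a₁ (d * l) *
              Skeleton.DeltaW D ((l : ℝ) / ((p : ℝ) * k)) else 0 := by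
  -- termwise: the filtered `k`-sum as an indicator sum, each summand factored
  have hterm : ∀ k ∈ Finset.Ico 1 (Skeleton.Nsupp D), ∀ l : ℕ,
      (if Nat.Coprime k l then
        MeanSquareMajorant.conv (Skeleton.kappaZ c' D) a₁ (d * l) * a₂ (d * k) *
            (ArithmeticFunction.moebius k : ℂ) / ((k : ℂ) * (Nat.totient k : ℂ)) *
          Skeleton.DeltaW D ((l : ℝ) / ((p : ℝ) * k)) else 0) =
      a₂ (d * k) * (ArithmeticFunction.moebius k : ℂ) / ((k : ℂ) * (Nat.totient k : ℂ)) *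
        (if 0 < l ∧ Nat.Coprime l k then
          MeanSquareMajorant.conv (Skeleton.kappaZ c' D) a₁ (d * l) *
            Skeleton.DeltaW D ((l : ℝ) / ((p : ℝ) * k)) else 0) := by
    intro k _ l
    rcases Nat.eq_zero_or_pos l with rfl | hl
    · simp [conv_zero]
    · simp only [hl, true_and, Nat.coprime_comm (m := k) (n := l)]
      split_ifs <;> ring
  have hsumm : ∀ k ∈ Finset.Ico 1 (Skeleton.Nsupp D), Summable fun l : ℕ =>
      (if Nat.Coprime k l then
        MeanSquareMajorant.conv (Skeleton.kappaZ c' D) a₁ (d * l) * a₂ (d * k) *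
            (ArithmeticFunction.moebius k : ℂ) / ((k : ℂ) * (Nat.totient k : ℂ)) *
          Skeleton.DeltaW D ((l : ℝ) / ((p : ℝ) * k)) else 0) := by
    intro k hk
    have hk0 : 0 < k := (Finset.mem_Ico.mp hk).1
    refine ((hasSum_u043 c' hD ha hd hk0 hp).summable.mul_left
      (a₂ (d * k) * (ArithmeticFunction.moebius k : ℂ) / ((k : ℂ) * (Nat.totient k : ℂ)))).congr
      fun l => (hterm k hk l).symm
  calc (∑' l : ℕ, ∑ k ∈ (Finset.Ico 1 (Skeleton.Nsupp D)).filter (fun k => Nat.Coprime k l),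
        MeanSquareMajorant.conv (Skeleton.kappaZ c' D) a₁ (d * l) * a₂ (d * k) *
            (ArithmeticFunction.moebius k : ℂ) / ((k : ℂ) * (Nat.totient k : ℂ)) *
          Skeleton.DeltaW D ((l : ℝ) / ((p : ℝ) * k)))
      = ∑' l : ℕ, ∑ k ∈ Finset.Ico 1 (Skeleton.Nsupp D),
          (if Nat.Coprime k l then
            MeanSquareMajorant.conv (Skeleton.kappaZ c' D) a₁ (d * l) * a₂ (d * k) *
                (ArithmeticFunction.moebius k : ℂ) / ((k : ℂ) * (Nat.totient k : ℂ)) *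
              Skeleton.DeltaW D ((l : ℝ) / ((p : ℝ) * k)) else 0) :=
        tsum_congr fun l => Finset.sum_filter _ _
    _ = ∑ k ∈ Finset.Ico 1 (Skeleton.Nsupp D), ∑' l : ℕ,
          (if Nat.Coprime k l then
            MeanSquareMajorant.conv (Skeleton.kappaZ c' D) a₁ (d * l) * a₂ (d * k) *
                (ArithmeticFunction.moebius k : ℂ) / ((k : ℂ) * (Nat.totient k : ℂ)) *
              Skeleton.DeltaW D ((l : ℝ) / ((p : ℝ) * k)) else 0) :=
        Summable.tsum_finsetSum hsumm
    _ = _ := by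
        refine Finset.sum_congr rfl fun k hk => ?_
        rw [tsum_congr (hterm k hk), tsum_mul_left]

/-- **`Z22:(7.16)` HOLDS** (node `Section7dStatements.Eq716 c′`; §7 p. 39, tex L2070: "Assume
`p ∼ P`. We may write `𝔗₁₁(p) = Σ_d d⁻¹ Σ_k a₂(dk)μ(k)/(kφ(k)) Σ_{(l,k)=1} (κ∗a₁)(dl)Δ(l/(pk))`")
— the `k`- and `l`-sums of `𝔗₁₁(p)` (typed `Iface.frakT11`) interchanged; for all `D ≥ 3`.
[cite: Zhang2022LandauSiegel, §7 (7.16) p.39, tex L2070] -/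
theorem eq716_holds (c' : ℝ) : Eq716 c' := by
  intro B
  refine ⟨3, fun D _ χ hD _ _ _ a₁ a₂ ha _ p hp => ?_⟩
  have hp' : 0 < p := by
    simp only [Skeleton.primeWindow, Finset.mem_filter] at hp
    exact hp.2.pos
  rw [Iface.frakT11]
  refine Finset.sum_congr rfl fun d hd => ?_
  have hd0 : 0 < d := (Finset.mem_Ico.mp hd).1
  rw [tsum_sum_filter_eq c' hD ha a₂ hd0 hp']

variable (c' : ℝ) in
/-- `Eq716` — `_holds` alias of `eq716_holds` above under the fact's exact name, stated under the
prover's own binders as section variables (appended 2026-08-28, D-0026 bookkeeping: the proof term is the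
existing theorem of this file; no statement, definition or attribute is edited; no new named fact; the
ledger's debt table listed the fact unproved). [cite: Zhang2022LandauSiegel, §7 (7.16) p.39, tex L2070] -/
theorem _root_.Literature.NumberTheory.LFunctions.Zhang2022.Section7dStatements.Eq716_holds :
    _root_.Literature.NumberTheory.LFunctions.Zhang2022.Section7dStatements.Eq716 c' :=
  _root_.Literature.NumberTheory.LFunctions.Zhang2022.Section7dStatements.eq716_holds (c' := c')

end Eq716

/-! ## `Z22:(7.18)` -/

section Eq718

variable (c' : ℝ) {D : ℕ}

/-- Double sums over `d₁, d₂ < N` of a function vanishing when `d₁d₂ ≥ N` regroup along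
`d = d₁d₂ < N`, `d₁ ∣ d`. [folklore] -/
private theorem sum_sum_eq_sum_divisors (N : ℕ) (Φ : ℕ → ℕ → ℂ)
    (hΦ : ∀ d₁ d₂ : ℕ, d₁ ∈ Finset.Ico 1 N → d₂ ∈ Finset.Ico 1 N → N ≤ d₁ * d₂ → Φ d₁ d₂ = 0) :
    ∑ d₁ ∈ Finset.Ico 1 N, ∑ d₂ ∈ Finset.Ico 1 N, Φ d₁ d₂ =
      ∑ d ∈ Finset.Ico 1 N, ∑ d₁ ∈ d.divisors, Φ d₁ (d / d₁) := by
  classical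
  -- right side: over the union of the antidiagonals of `d < N`
  have hR : ∑ d ∈ Finset.Ico 1 N, ∑ d₁ ∈ d.divisors, Φ d₁ (d / d₁) =
      ∑ x ∈ (Finset.Ico 1 N).biUnion Nat.divisorsAntidiagonal, Φ x.1 x.2 := by
    rw [Finset.sum_biUnion]
    · exact Finset.sum_congr rfl fun d _ => (Nat.sum_divisorsAntidiagonal fun a b => Φ a b).symm
    · intro n _ m _ hnm
      refine Finset.disjoint_left.mpr fun x hx hx' => hnm ?_
      rw [← (Nat.mem_divisorsAntidiagonal.mp hx).1, ← (Nat.mem_divisorsAntidiagonal.mp hx').1]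
  rw [hR, ← Finset.sum_product']
  symm
  refine Finset.sum_subset (fun x hx => ?_) (fun x hx hx' => ?_)
  · obtain ⟨d, hd, hx⟩ := Finset.mem_biUnion.mp hx
    obtain ⟨hxd, hd0⟩ := Nat.mem_divisorsAntidiagonal.mp hx
    have hdN := (Finset.mem_Ico.mp hd).2
    have h1 : x.1 ≠ 0 := fun h => hd0 (by rw [← hxd, h, zero_mul])
    have h2 : x.2 ≠ 0 := fun h => hd0 (by rw [← hxd, h, mul_zero])
    have h1' : x.1 ≤ d := by rw [← hxd]; exact Nat.le_mul_of_pos_right _ (Nat.pos_of_ne_zero h2)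
    have h2' : x.2 ≤ d := by rw [← hxd]; exact Nat.le_mul_of_pos_left _ (Nat.pos_of_ne_zero h1)
    refine Finset.mem_product.mpr ⟨Finset.mem_Ico.mpr ⟨Nat.pos_of_ne_zero h1, by omega⟩,
      Finset.mem_Ico.mpr ⟨Nat.pos_of_ne_zero h2, by omega⟩⟩
  · obtain ⟨h1, h2⟩ := Finset.mem_product.mp hx
    have hN : N ≤ x.1 * x.2 := by
      by_contra hlt
      push Not at hlt
      refine hx' (Finset.mem_biUnion.mpr ⟨x.1 * x.2, Finset.mem_Ico.mpr ⟨?_, hlt⟩, ?_⟩)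
      · exact Nat.mul_pos (Finset.mem_Ico.mp h1).1 (Finset.mem_Ico.mp h2).1
      · exact Nat.mem_divisorsAntidiagonal.mpr ⟨rfl,
          (Nat.mul_pos (Finset.mem_Ico.mp h1).1 (Finset.mem_Ico.mp h2).1).ne'⟩
    exact hΦ x.1 x.2 h1 h2 hN

/-- **`Z22:(7.18)` HOLDS** (node `Section7dStatements.Eq718 c′`; §7 p. 39, tex L2087: "Inserting
this into (7.16) we obtain `𝔗₁₁(p) = Σ_{d₁}Σ_{d₂}(d₁d₂)⁻¹Σ_k a₂(d₁d₂k)μ(k)/(kφ(k))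
Σ_{(l₂,k)=1} a₁(d₂l₂) Σ_{(l₁,d₂k)=1} κ(d₁l₁)Δ(l₁l₂/(pk))`") — (7.16) and `Z22:§7.u043` combined,
the pair `(d, d₁ ∣ d)` re-indexed as `(d₁, d₂)` with `d = d₁d₂`, the terms with `d₁d₂ ≥ ⌈PT⁻²⌉`
vanishing by the support clause of (7.2) for `a₂`; for all `D ≥ 3`.
[cite: Zhang2022LandauSiegel, §7 (7.18) p.39, tex L2087] -/
theorem eq718_holds (c' : ℝ) : Eq718 c' := by
  intro B
  refine ⟨3, fun D _ χ hD _ _ _ a₁ a₂ ha₁ ha₂ p hp => ?_⟩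
  have hp' : 0 < p := by
    simp only [Skeleton.primeWindow, Finset.mem_filter] at hp
    exact hp.2.pos
  set N : ℕ := Skeleton.Nsupp D with hN
  -- abbreviations
  set R : ℕ → ℕ → ℕ → ℂ := fun d₁ d₂ k =>
    ∑' l₂ : ℕ, if 0 < l₂ ∧ Nat.Coprime l₂ k then
      a₁ (d₂ * l₂) * innerDeltaSum c' D d₁ (d₂ * k) ((l₂ : ℝ) / ((p : ℝ) * k)) else 0 with hR
  set cμ : ℕ → ℕ → ℂ := fun n k =>
    a₂ (n * k) * (ArithmeticFunction.moebius k : ℂ) / ((k : ℂ) * (Nat.totient k : ℂ)) with hcμ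
  set Φ : ℕ → ℕ → ℂ := fun d₁ d₂ =>
    ((d₁ : ℂ) * d₂)⁻¹ * ∑ k ∈ Finset.Ico 1 N, cμ (d₁ * d₂) k * R d₁ d₂ k with hΦ
  -- (7.16), then u043 inside
  have h716 : Iface.frakT11 c' D a₁ a₂ p =
      ∑ d ∈ Finset.Ico 1 N, (d : ℂ)⁻¹ * ∑ k ∈ Finset.Ico 1 N, cμ d k *
        ∑ d₁ ∈ d.divisors, R d₁ (d / d₁) k := by
    rw [Iface.frakT11]
    refine Finset.sum_congr rfl fun d hd => ?_
    have hd0 : 0 < d := (Finset.mem_Ico.mp hd).1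
    rw [tsum_sum_filter_eq c' hD ha₁ a₂ hd0 hp']
    congr 1
    refine Finset.sum_congr rfl fun k hk => ?_
    have hk0 : 0 < k := (Finset.mem_Ico.mp hk).1
    rw [(hasSum_u043 c' hD ha₁ hd0 hk0 hp').tsum_eq]
  -- regroup `d⁻¹ Σ_k c Σ_{d₁∣d} R = Σ_{d₁∣d} Φ d₁ (d/d₁)`
  have hgroup : ∀ d ∈ Finset.Ico 1 N,
      (d : ℂ)⁻¹ * ∑ k ∈ Finset.Ico 1 N, cμ d k * ∑ d₁ ∈ d.divisors, R d₁ (d / d₁) k =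
        ∑ d₁ ∈ d.divisors, Φ d₁ (d / d₁) := by
    intro d _
    have hrw : ∀ d₁ ∈ d.divisors, Φ d₁ (d / d₁) =
        (d : ℂ)⁻¹ * ∑ k ∈ Finset.Ico 1 N, cμ d k * R d₁ (d / d₁) k := by
      intro d₁ hd₁
      have hmul : d₁ * (d / d₁) = d := Nat.mul_div_cancel' (Nat.dvd_of_mem_divisors hd₁)
      simp only [hΦ]
      rw [← Nat.cast_mul, hmul]
    rw [Finset.sum_congr rfl hrw, ← Finset.mul_sum, Finset.sum_comm]
    congr 1
    refine Finset.sum_congr rfl fun k _ => ?_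
    rw [Finset.mul_sum]
  -- vanishing of `Φ` for `d₁d₂ ≥ N`
  have hvanish : ∀ d₁ d₂ : ℕ, d₁ ∈ Finset.Ico 1 N → d₂ ∈ Finset.Ico 1 N → N ≤ d₁ * d₂ →
      Φ d₁ d₂ = 0 := by
    intro d₁ d₂ _ _ hle
    simp only [hΦ]
    refine mul_eq_zero_of_right _ (Finset.sum_eq_zero fun k hk => ?_)
    have hk1 : 1 ≤ k := (Finset.mem_Ico.mp hk).1
    have hge : Skeleton.bigP D / Skeleton.bigT D ^ 2 ≤ ((d₁ * d₂ * k : ℕ) : ℝ) := by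
      have h1 : Skeleton.bigP D / Skeleton.bigT D ^ 2 ≤ (N : ℝ) := Nat.le_ceil _
      have h2 : (N : ℝ) ≤ ((d₁ * d₂ : ℕ) : ℝ) := by exact_mod_cast hle
      have h3 : ((d₁ * d₂ : ℕ) : ℝ) ≤ ((d₁ * d₂ * k : ℕ) : ℝ) := by
        exact_mod_cast Nat.le_mul_of_pos_right _ hk1
      linarith
    simp only [hcμ, ha₂.2 _ hge, zero_mul, zero_div]
  rw [h716, Finset.sum_congr rfl hgroup, ← sum_sum_eq_sum_divisors N Φ hvanish]

variable (c' : ℝ) in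
/-- `Eq718` — `_holds` alias of `eq718_holds` above under the fact's exact name, stated under the
prover's own binders as section variables (appended 2026-08-28, D-0026 bookkeeping: the proof term is the
existing theorem of this file; no statement, definition or attribute is edited; no new named fact; the
ledger's debt table listed the fact unproved). [cite: Zhang2022LandauSiegel, §7 (7.18) p.39, tex L2087] -/
theorem _root_.Literature.NumberTheory.LFunctions.Zhang2022.Section7dStatements.Eq718_holds :
    _root_.Literature.NumberTheory.LFunctions.Zhang2022.Section7dStatements.Eq718 c' :=
  _root_.Literature.NumberTheory.LFunctions.Zhang2022.Section7dStatements.eq718_holds (c' := c')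

end Eq718

end Literature.NumberTheory.LFunctions.Zhang2022.Section7dStatements

end
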